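import Literature.Analysis.FluidPDE.SawtoothCascade
import Literature.Analysis.FluidPDE.PassiveScalar
import Literature.Analysis.FunctionSpaces.TorusFourierCalculus
import Literature.Analysis.FunctionSpaces.TorusRieszFischerParam
import Literature.Analysis.FunctionSpaces.TorusTrigPoly
import Literature.Analysis.FunctionSpaces.TorusSobolevNorm

/-!
# K1loc — helper: THE SPECTRUM OF THE DATUM `sin 2πx₁` (two modes `±e₀` of energy `¼` each; `‖datum‖² = ½`)

Helper file of the prover lane on the crux `K1LocalisedCascade` (stmt-AnomalousDissipation-19491), route
`SawtoothPulseCascade` (S-B/S-C assembly seat).  The numbers of record behind every budget of the S-D target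
(`…LedgerThinTarget`: `LowBand_n + HighOffCone_n ≤ Q < ‖datum‖²`; the certified starts of the crux ideas): as a complex
function the datum is `(I/2)·(e_{−e₀} − e_{e₀})` (`coe_datum_eq`), so `𝓕datum(k) = (I/2)([k = −e₀] − [k = e₀])`
(`mFourierCoeff_datum`), `‖𝓕datum(k)‖² = ¼·[k = ±e₀]` (`sq_norm_mFourierCoeff_datum`), every weighted spectral functional of the
datum is `(W(e₀) + W(−e₀))/4` (`tsum_weight_sq_norm_mFourierCoeff_datum`), and `‖datum‖²_{L²} = ½` (`scalarL2Sq_datum`,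
Parseval; `continuous_datum` from the character form, so this file imports no route file).  No definitions. [cite: Grafakos2014, Prop. 3.2.7 (3) (Parseval; orthonormality of the characters)] [problem: turb]
-/

-- `Summit.<Summit>.<Problem>`: single-conjunct summit, the duplicate namespace segment is deliberate.
set_option linter.dupNamespace false

noncomputable section

namespace Summit.AnomalousDissipation.AnomalousDissipation.Theorems.SawtoothPulseCascade.K1Start

open MeasureTheory Set Filter Topology UnitAddTorus Function Complex
open Literature.Analysis Literature.Analysis.FunctionSpaces Literature.Analysis.FunctionSpaces.Torus Literature.Analysis.FluidPDE
open Literature.Analysis.FluidPDE.SawtoothCascade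

/-- **The datum as a difference of two characters**: `(sin 2πx₁ : ℂ) = (I/2)·(e_{−e₀}(x) − e_{e₀}(x))`. [folklore] -/
theorem coe_datum_eq (x : UnitAddTorus (Fin 2)) :
    (datum x : ℂ) = I / 2 * (mFourier (-Pi.single 0 1) x - mFourier (Pi.single 0 1) x) := by
  -- the first coordinate through its representative
  have hx : x 0 = ((Torus.repr x 0 : ℝ) : UnitAddCircle) := by
    have h := congrFun (Torus.proj_repr x) 0
    rw [Torus.proj_apply] at h
    exact h.symm
  have h1 : mFourier (Pi.single 0 1) x = Complex.exp (2 * Real.pi * I * (Torus.repr x 0 : ℝ)) := by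
    rw [UnitAddTorus.mFourier_single, hx, fourier_coe_apply]
    congr 1; push_cast; ring
  have h2 : mFourier (-Pi.single 0 1) x = Complex.exp (-(2 * Real.pi * I * (Torus.repr x 0 : ℝ))) := by
    rw [mFourier_neg, h1, ← Complex.exp_conj]
    congr 1
    simp only [map_mul, map_ofNat, Complex.conj_ofReal, Complex.conj_I]
    ring
  rw [h1, h2]
  show ((Real.sin (2 * Real.pi * Torus.repr x 0) : ℝ) : ℂ) = _
  rw [Complex.ofReal_sin, Complex.sin]
  push_cast
  ring_nf

/-- The datum is continuous (it is the real part of a trigonometric polynomial). [folklore] -/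
theorem continuous_datum : Continuous datum := by
  have h : datum = fun x => (I / 2 * (mFourier (-Pi.single 0 1) x - mFourier (Pi.single 0 1) x)).re := by
    funext x
    rw [← coe_datum_eq x, Complex.ofReal_re]
  rw [h]
  exact Complex.continuous_re.comp (continuous_const.mul ((mFourier _).continuous.sub (mFourier _).continuous))

/-- **Fourier coefficients of the datum**: `𝓕datum(k) = (I/2)·([k = −e₀] − [k = e₀])`.
[cite: Grafakos2014, Prop. 3.2.7 (3) (orthonormality of the characters)] -/
theorem mFourierCoeff_datum (k : Fin 2 → ℤ) :
    mFourierCoeff (fun x => (datum x : ℂ)) k =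
      I / 2 * ((if k = -Pi.single 0 1 then (1 : ℂ) else 0) - (if k = Pi.single 0 1 then (1 : ℂ) else 0)) := by
  classical
  have hf : (fun x => (datum x : ℂ)) = (I / 2) • (⇑(mFourier (-Pi.single (0 : Fin 2) (1 : ℤ))) - ⇑(mFourier (Pi.single 0 1))) := by
    funext x
    rw [coe_datum_eq x, Pi.smul_apply, Pi.sub_apply, smul_eq_mul]
  have hi : ∀ l : Fin 2 → ℤ, Integrable (⇑(mFourier l) : UnitAddTorus (Fin 2) → ℂ) volume := fun l =>
    (mFourier l).continuous.integrable_of_hasCompactSupport (HasCompactSupport.of_compactSpace _)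
  rw [hf, mFourierCoeff_const_smul, mFourierCoeff_sub (hi _) (hi _), Torus.mFourierCoeff_mFourier,
    Torus.mFourierCoeff_mFourier, smul_eq_mul]

/-- `e₀ ≠ −e₀` on the frequency lattice. [folklore] -/
theorem single_ne_neg_single : (Pi.single 0 1 : Fin 2 → ℤ) ≠ -Pi.single 0 1 := by
  intro h
  have h0 := congrFun h 0
  simp at h0

/-- **Energies of the datum's modes**: `‖𝓕datum(k)‖² = ¼` for `k = ±e₀`, `0` otherwise.
[cite: Grafakos2014, Prop. 3.2.7 (3)] -/
theorem sq_norm_mFourierCoeff_datum (k : Fin 2 → ℤ) :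
    ‖mFourierCoeff (fun x => (datum x : ℂ)) k‖ ^ 2 =
      if k = Pi.single 0 1 ∨ k = -Pi.single 0 1 then (1 / 4 : ℝ) else 0 := by
  rw [mFourierCoeff_datum k]
  by_cases h1 : k = Pi.single 0 1
  · have h2 : k ≠ -Pi.single 0 1 := by rw [h1]; exact single_ne_neg_single
    rw [if_neg h2, if_pos h1, if_pos (Or.inl h1), norm_mul, mul_pow]
    simp; norm_num
  · by_cases h2 : k = -Pi.single 0 1
    · rw [if_pos h2, if_neg h1, if_pos (Or.inr h2), norm_mul, mul_pow]
      simp; norm_num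
    · rw [if_neg h1, if_neg h2, if_neg (not_or.2 ⟨h1, h2⟩)]
      simp

/-- **Weighted spectral functionals of the datum**: `Σ' k, W(k)·‖𝓕datum(k)‖² = (W(e₀) + W(−e₀))/4` for every `W`.
[cite: Grafakos2014, Prop. 3.2.7 (3)] -/
theorem tsum_weight_sq_norm_mFourierCoeff_datum (W : (Fin 2 → ℤ) → ℝ) :
    ∑' k : Fin 2 → ℤ, W k * ‖mFourierCoeff (fun x => (datum x : ℂ)) k‖ ^ 2 =
      (W (Pi.single 0 1) + W (-Pi.single 0 1)) / 4 := by
  classical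
  have hsupp : ∀ k ∉ ({Pi.single 0 1, -Pi.single 0 1} : Finset (Fin 2 → ℤ)),
      W k * ‖mFourierCoeff (fun x => (datum x : ℂ)) k‖ ^ 2 = 0 := by
    intro k hk
    rw [Finset.mem_insert, Finset.mem_singleton, not_or] at hk
    rw [sq_norm_mFourierCoeff_datum, if_neg (not_or.2 hk), mul_zero]
  rw [tsum_eq_sum hsupp, Finset.sum_pair single_ne_neg_single, sq_norm_mFourierCoeff_datum, sq_norm_mFourierCoeff_datum,
    if_pos (Or.inl rfl), if_pos (Or.inr rfl)]
  ring

/-- **The energy of the datum**: `‖sin 2πx₁‖²_{L²(𝕋²)} = ½`. [cite: Grafakos2014, Prop. 3.2.7 (3) (Parseval)] -/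
theorem scalarL2Sq_datum : FluidPDE.Torus.scalarL2Sq datum = 1 / 2 := by
  have hP : HasSum (fun k => ‖mFourierCoeff (fun x => (datum x : ℂ)) k‖ ^ 2) (∫ x, ‖((datum x : ℝ) : ℂ)‖ ^ 2) :=
    hasSum_sq_mFourierCoeff_of_continuous (continuous_ofReal.comp continuous_datum)
  have hint : ∫ x, ‖((datum x : ℝ) : ℂ)‖ ^ 2 = FluidPDE.Torus.scalarL2Sq datum := by
    unfold FluidPDE.Torus.scalarL2Sq
    refine integral_congr_ae (ae_of_all _ fun x => ?_)
    show ‖((datum x : ℝ) : ℂ)‖ ^ 2 = datum x ^ 2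
    rw [Complex.norm_real, Real.norm_eq_abs, sq_abs]
  rw [← hint, ← hP.tsum_eq]
  have h := tsum_weight_sq_norm_mFourierCoeff_datum (fun _ => 1)
  simp only [one_mul] at h
  rw [h]; norm_num

/-- **The energy of the datum, root form**: `‖datum‖_{L²} = 1/√2`, i.e. `√(scalarL2Sq datum) = √(1/2)`. [folklore] -/
theorem sqrt_scalarL2Sq_datum : Real.sqrt (FluidPDE.Torus.scalarL2Sq datum) = Real.sqrt (1 / 2) := by
  rw [scalarL2Sq_datum]

/-- **The datum has no low horizontal modes and no steep modes**: for any `L ≤ 1` and any `a`, `γ` with `0 < a`,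
`Σ'[|k₀| < L]‖𝓕datum‖² = 0` and `Σ'[a|k₀| ≤ γ|k₁|]‖𝓕datum‖² = 0` (its two modes are `(±1, 0)`).
[cite: Grafakos2014, Prop. 3.2.7 (3)] -/
theorem tsum_lowBand_datum_eq_zero {L : ℝ} (hL : L ≤ 1) :
    ∑' k : Fin 2 → ℤ, (if |((k 0 : ℤ) : ℝ)| < L then (1 : ℝ) else 0) * ‖mFourierCoeff (fun x => (datum x : ℂ)) k‖ ^ 2 = 0 := by
  rw [tsum_weight_sq_norm_mFourierCoeff_datum]
  have h1 : ¬ |(((Pi.single 0 1 : Fin 2 → ℤ) 0 : ℤ) : ℝ)| < L := by simp; linarith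
  have h2 : ¬ |(((-Pi.single 0 1 : Fin 2 → ℤ) 0 : ℤ) : ℝ)| < L := by simp; linarith
  rw [if_neg h1, if_neg h2]; norm_num

/-- See `tsum_lowBand_datum_eq_zero`: the steep-cone functional of the datum vanishes for `a > 0`. [cite: Grafakos2014, Prop. 3.2.7 (3)] -/
theorem tsum_cone_datum_eq_zero (γ : ℝ) {a : ℝ} (ha : 0 < a) :
    ∑' k : Fin 2 → ℤ, (if a * |((k 0 : ℤ) : ℝ)| ≤ γ * |((k 1 : ℤ) : ℝ)| then (1 : ℝ) else 0) *
      ‖mFourierCoeff (fun x => (datum x : ℂ)) k‖ ^ 2 = 0 := by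
  rw [tsum_weight_sq_norm_mFourierCoeff_datum]
  have h1 : ¬ a * |(((Pi.single 0 1 : Fin 2 → ℤ) 0 : ℤ) : ℝ)| ≤ γ * |(((Pi.single 0 1 : Fin 2 → ℤ) 1 : ℤ) : ℝ)| := by
    simp; linarith
  have h2 : ¬ a * |(((-Pi.single 0 1 : Fin 2 → ℤ) 0 : ℤ) : ℝ)| ≤ γ * |(((-Pi.single 0 1 : Fin 2 → ℤ) 1 : ℤ) : ℝ)| := by
    simp; linarith
  rw [if_neg h1, if_neg h2]; norm_num

end Summit.AnomalousDissipation.AnomalousDissipation.Theorems.SawtoothPulseCascade.K1Start
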